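import Summits.RiemannHypothesis.RiemannHypothesis.Theorems.Splittings.PolyDoorDomination
import Summits.RiemannHypothesis.RiemannHypothesis.Theorems.Splittings.PolyDoorLocalSign
import Literature.NumberTheory.Transcendental.JungRootStructure

/-!
# LINE L13 «DBR POLYNOMIAL DOOR» — node 5 (the negative direction): a non-real root of `p` forces a zero of `E_p` in `ℂ₊`

Cell rh-split, route `DeBrangesSuzukiDoor`, item `stmt-RiemannHypothesis-21500` (`PolyDoorNegative`, registrar
rh-split-dbr-neg g16).  PORT of the registrar's kernel-checked glue `negative_of_nodes` (skeleton `LineDbrB0.lean`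
fbf1fd8c172cea0f) onto the landed by-value nodes `polyDoorDomination` (node 3, item 21498) and `polyDoorLocalSign`
(node 4, item 21499).  Argument: let `p ≠ 0` be real with a non-real root; by conjugation symmetry it has a root
`a` with `Im a > 0`.  If `E_p = p_ℂ + i p_ℂ′` had no zero in `ℂ₊`, all its roots lie in the closed lower
half-plane, so node 3 gives `‖E_p^*(z)‖ ≤ ‖E_p(z)‖` on `ℂ₊`, where `E_p^*(z) = p_ℂ(z) − i p_ℂ′(z)` (real
coefficients); with `|u + iv|² − |u − iv|² = 4·Im(u·conj v)` this says `Im (p_ℂ · conj p_ℂ′) ≥ 0` on `ℂ₊`,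
contradicting node 4 just below `a`.

Proved BY VALUE (the item's `payload.signature` verbatim; the route file does not yet declare the decl).
Classical (Hermite–Biehler for `(p, p′)`, Levin 1964 ch. VII); E-GENERAL, RH-free.
HONEST LABEL: known mathematics, RECORD line, 0 summit credit; nothing here bears on the truth of RH.
-/

set_option linter.dupNamespace false

namespace Summit.RiemannHypothesis.RiemannHypothesis.Theorems.Splittings.PolyDoorNegative

open Polynomial
open scoped ComplexConjugate
open Summit.RiemannHypothesis.RiemannHypothesis.Theorems.Splittings.PolyDoorDomination (polyDoorDomination)
open Summit.RiemannHypothesis.RiemannHypothesis.Theorems.Splittings.PolyDoorLocalSign (polyDoorLocalSign)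
open Literature.NumberTheory.Transcendental.JungPreparation (eval_conj_map_ofReal map_conj_map_ofReal)

/-- The norm identity behind «domination ⟹ sign»: `|u + iv|² − |u − iv|² = 4 · Im (u · conj v)`.
[folklore] (skeleton `LineDbrB0.norm_identity`.) -/
theorem normSq_add_I_mul_sub_normSq_sub_I_mul (u v : ℂ) :
    Complex.normSq (u + Complex.I * v) - Complex.normSq (u - Complex.I * v) = 4 * (u * conj v).im := by
  rw [Complex.normSq_apply, Complex.normSq_apply]
  simp only [Complex.add_re, Complex.mul_re, Complex.I_re, zero_mul, Complex.I_im, one_mul, zero_sub,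
    Complex.add_im, Complex.mul_im, zero_add, Complex.sub_re, sub_neg_eq_add, Complex.sub_im,
    Complex.conj_re, Complex.conj_im]
  ring

/-- The reflected door of a real polynomial: `(E_p)^*(z) = ((p_ℂ + i p_ℂ′).map conj)(z) = p_ℂ(z) − i·p_ℂ′(z)`.
[folklore] (skeleton `LineDbrB0.reflect_doorE_eval`.) -/
theorem eval_map_conj_door (p : ℝ[X]) (z : ℂ) :
    ((p.map (algebraMap ℝ ℂ) + C Complex.I * derivative (p.map (algebraMap ℝ ℂ))).map (starRingEnd ℂ)).eval z
      = (p.map (algebraMap ℝ ℂ)).eval z - Complex.I * (derivative (p.map (algebraMap ℝ ℂ))).eval z := by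
  have hd : (derivative (p.map (algebraMap ℝ ℂ))).map (starRingEnd ℂ) = derivative (p.map (algebraMap ℝ ℂ)) := by
    rw [← Polynomial.derivative_map, map_conj_map_ofReal]
  simp only [Polynomial.map_add, Polynomial.map_mul, Polynomial.map_C, map_conj_map_ofReal, hd,
    eval_add, eval_mul, eval_C, Complex.conj_I]
  ring

/-- **Node 5 of LINE L13 (item `stmt-RiemannHypothesis-21500`, `PolyDoorNegative` by value).**
A non-real root of the real polynomial `p ≠ 0` forces a zero of `E_p = p_ℂ + i p_ℂ′` in the open upper
half-plane.  Port of the registrar's glue `negative_of_nodes` onto nodes 3 and 4. [folklore]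
(Hermite–Biehler for `(p, p′)`; Levin, *Distribution of zeros of entire functions*, ch. VII.) -/
theorem polyDoorNegative :
    ∀ p : Polynomial ℝ, p ≠ 0 → (∃ z : ℂ, z.im ≠ 0 ∧ (p.map (algebraMap ℝ ℂ)).eval z = 0) →
      ∃ z : ℂ, 0 < z.im ∧ (p.map (algebraMap ℝ ℂ) + Polynomial.C Complex.I *
        Polynomial.derivative (p.map (algebraMap ℝ ℂ))).eval z = 0 := by
  intro p hp hex
  obtain ⟨z₀, hz₀, hroot⟩ := hex
  -- an upper root `a` of `p_ℂ`: `z₀` or its conjugate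
  obtain ⟨a, ha, haroot⟩ : ∃ a : ℂ, 0 < a.im ∧ (p.map (algebraMap ℝ ℂ)).eval a = 0 := by
    rcases lt_or_gt_of_ne hz₀ with h | h
    · refine ⟨conj z₀, ?_, ?_⟩
      · rw [Complex.conj_im]
        linarith
      · rw [eval_conj_map_ofReal, hroot, map_zero]
    · exact ⟨z₀, h, hroot⟩
  by_contra hnone
  have hnone' : ∀ z : ℂ, 0 < z.im → (p.map (algebraMap ℝ ℂ) + Polynomial.C Complex.I *
      Polynomial.derivative (p.map (algebraMap ℝ ℂ))).eval z ≠ 0 := fun z hz h => hnone ⟨z, hz, h⟩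
  obtain ⟨z, hz, hsign⟩ := polyDoorLocalSign p hp a ha haroot
  -- all roots of `E_p` lie in the closed lower half-plane
  have hE0 : p.map (algebraMap ℝ ℂ) + Polynomial.C Complex.I *
      Polynomial.derivative (p.map (algebraMap ℝ ℂ)) ≠ 0 := by
    intro h0
    exact hnone' z hz (by rw [h0, eval_zero])
  have hroots : ∀ e ∈ (p.map (algebraMap ℝ ℂ) + Polynomial.C Complex.I *
      Polynomial.derivative (p.map (algebraMap ℝ ℂ))).roots, e.im ≤ 0 := by
    intro e he
    rw [Polynomial.mem_roots hE0] at he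
    by_contra hpos
    exact hnone' e (lt_of_not_ge hpos) he
  -- domination gives `Im (p_ℂ conj p_ℂ′) ≥ 0` at `z ∈ ℂ₊`, contradicting the local sign
  have hdom := polyDoorDomination _ hroots z hz
  rw [eval_map_conj_door, eval_add, eval_mul, eval_C] at hdom
  have hsq : Complex.normSq ((p.map (algebraMap ℝ ℂ)).eval z -
      Complex.I * (derivative (p.map (algebraMap ℝ ℂ))).eval z)
      ≤ Complex.normSq ((p.map (algebraMap ℝ ℂ)).eval z +
      Complex.I * (derivative (p.map (algebraMap ℝ ℂ))).eval z) := by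
    rw [Complex.normSq_eq_norm_sq, Complex.normSq_eq_norm_sq]
    exact pow_le_pow_left₀ (norm_nonneg _) hdom 2
  have hid := normSq_add_I_mul_sub_normSq_sub_I_mul ((p.map (algebraMap ℝ ℂ)).eval z)
    ((derivative (p.map (algebraMap ℝ ℂ))).eval z)
  linarith

end Summit.RiemannHypothesis.RiemannHypothesis.Theorems.Splittings.PolyDoorNegative
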